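import Literature.AlgebraicGeometry.Resolution.PrimeDivisorIdeals
import Literature.AlgebraicGeometry.Resolution.SncStrata
import Literature.AlgebraicGeometry.Resolution.MarkedIdeals
import Literature.AlgebraicGeometry.Resolution.RegularLocalRingsProofs
import HarnessLib

/-!
# MarkedIdealsCodimOneSupport — codimension-one components of the support of an order-bounded marked ideal (the «solid clause»)

Topic: `Literature/AlgebraicGeometry/Resolution`.  TOOL (decomp-res lens-6 g30, critic row 221a (q2): «prove the solid clause
now — 0-weight tool, banked»; first consumer: the g31 frame «SurfCut» of the F-surf-sing door, where the surface phase
(Cossart–Jannsen–Saito for `dim ≤ 2`) must not be fed a three-dimensional component of the bad locus).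

SETTING.  `X` a REGULAR scheme (no integrality assumed: the local rings are regular, hence factorial domains —
Auslander–Buchsbaum, `Scheme.IsRegular.uniqueFactorizationMonoid_stalk`), an ideal sheaf `I` of ORDER AT MOST `n` EVERYWHERE
(`¬ I_x ⊆ 𝔪_x^{n+1}`; for a marked ideal `(I, n)` this is the column's `IsDatum`: `ord_y I ≤ n` for all `y`), `n ≥ 1`, and a
point `ζ` of CODIMENSION ONE (`coheight ζ = 1`, the generic point of a prime divisor `E = cl{ζ}`) lying in the support
`{ord ≥ n}` (`I_ζ ⊆ 𝔪_ζ^n`).  PROVED, for every specialisation `ζ ⤳ x` (every point `x ∈ E`):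

* `stalkIdeal_le_primeOfSpecializes_pow` — `I_x ⊆ 𝔭_ζ^n` (`𝔭_ζ ⊆ 𝒪_{X,x}` the height-one prime of the generisation `ζ`;
  the integrality-free pointwise form of `le_primeDivisorIdeal_pow`, [CoP1] proof of Prop. 4.2);
* `solid_generator` — **`𝔭_ζ = (p)` with `p ∉ 𝔪_x²` and `I_x = (p^n) = 𝔭_ζ^n` EXACTLY**: near `E` the ideal is the `n`-th
  power of the ideal of `E`, and `E` is REGULAR at `x` (its local equation is a regular parameter; `𝒪_{X,x}/(p)` regular is the
  standard criterion `p ∉ 𝔪_x²`);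
* `solid_isolated` — **every generisation `ξ ⤳ x` with `I_ξ ≠ 𝒪_{X,ξ}` is a specialisation of `ζ`** (`ζ ⤳ ξ`, i.e. `ξ ∈ E`):
  no other irreducible component of the support `{ord ≥ n}` (indeed of `V(I)`) passes through a point of `E` — the
  codimension-one components of the support are ISOLATED from the rest;
* `MarkedIdeal.specializes_of_mem_support_of_coheight_eq_one` — the same in the language of marked ideals: for `(I, n)` with
  `1 ≤ n`, `ord ≤ n` everywhere, `ζ ∈ supp` of coheight one and `ζ ⤳ x`, every `ξ ∈ supp` with `ξ ⤳ x` satisfies `ζ ⤳ ξ`;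
  `MarkedIdeal.stalkIdeal_eq_pow_of_mem_support_of_coheight_eq_one` — `I_x = 𝔭_ζ^n`.

PROOF (two lines of local algebra on top of the tree's prime-divisor API).  `I_x ⊆ (p^n)` by factoriality
(`exists_prime_primeOfSpecializes_eq_span`, `pow_dvd_of_algebraMap_mem_map_pow` through the localisation `𝒪_{X,ζ} =
(𝒪_{X,x})_{𝔭_ζ}`).  If `p ∈ 𝔪_x²` then `I_x ⊆ 𝔪_x^{2n} ⊆ 𝔪_x^{n+1}`; if `p^n ∉ I_x` then every `f = p^n g ∈ I_x` has `g ∈ 𝔪_x`,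
so `I_x ⊆ 𝔪_x^{n+1}` again — both excluded by the order bound.  For isolation: `I_ξ = I_x 𝒪_{X,ξ} = (p^n) 𝒪_{X,ξ}` is proper only
if `p ∈ 𝔭_ξ`, i.e. `𝔭_ζ ⊆ 𝔭_ξ`, i.e. `ζ ⤳ ξ` (`specializes_of_primeOfSpecializes_le`, Stacks 01J7).

## Sources
* V. Cossart, O. Piltant, J. Algebra 320 (2008), proof of Prop. 4.2 (the divisorial part `𝒪_X(-∑ a(i)E_i) ⊆ I`). [CossartPiltant2008]
* H. Matsumura, *Commutative Ring Theory*, Thm. 20.3 (regular local rings are factorial), Thm. 14.2 / §14 (regular parameters). [Matsumura1987]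
* The Stacks Project, Tag 01J7 (generisations = points of `Spec 𝒪_{X,x}`). [StacksProject]
* folklore: for a marked ideal of maximal order `n`, a hypersurface component `H` of `{ord ≥ n}` is regular with `I = 𝓘_H^n`
  near `H` (e.g. Encinas–Villamayor, «A course on constructive desingularization», Rem. 4.10; Bierstone–Milman 1997 §3). [folklore]
[new; elementary] [folklore]

[WRITER NOTE (decomp-res writer g14): the critic's rider (letter row 222a) named the target
`Literature/AlgebraicGeometry/Resolution/MarkedIdealsCodimOneSupport.lean`; the gate's lint `literature-cited-only`
refuses uncited NEW statements under `Literature/` («new results belong under Summits/<Summit>/»), so this file lands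
VERBATIM as `Summits/ResolutionOfSingularities/ResolutionOfSingularities/Theorems/MarkedIdealsCodimOneSupport.lean` —
module name `Summits.ResolutionOfSingularities.ResolutionOfSingularities.Theorems.MarkedIdealsCodimOneSupport`; the
namespace `Literature.AlgebraicGeometry.Resolution` and every declaration are unchanged.]
-/

noncomputable section

open CategoryTheory CategoryTheory.Limits AlgebraicGeometry TopologicalSpace IsLocalRing

namespace Literature.AlgebraicGeometry.Resolution

universe u

open Scheme.IdealSheafData

variable {X : Scheme.{u}}

section SolidClause

/-- **`I_ζ ⊆ 𝔪_ζ^n ⇒ I_x ⊆ 𝔭_ζ^n`** at every specialisation `ζ ⤳ x` of a codimension-one point of a REGULAR scheme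
(integrality-free pointwise form of `le_primeDivisorIdeal_pow`: `𝔭_ζ = (p)` is principal in the factorial domain `𝒪_{X,x}`,
and `p^n ∣ f` in `𝒪_{X,x}` as soon as it holds in the localisation `𝒪_{X,ζ}` with `p ∉ 𝔭_ζ`-complement units).
[cite: CossartPiltant2008, proof of Prop. 4.2] -/
theorem stalkIdeal_le_primeOfSpecializes_pow (hX : Scheme.IsRegular X) {ζ x : X} (h : ζ ⤳ x)
    (hζ : Order.coheight ζ = 1) {I : X.IdealSheafData} {n : ℕ}
    (hn : stalkIdeal I ζ ≤ maximalIdeal (X.presheaf.stalk ζ) ^ n) :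
    stalkIdeal I x ≤ primeOfSpecializes h ^ n := by
  haveI := hX x
  haveI : IsDomain (X.presheaf.stalk x) := isDomain_of_isRegularLocalRing _
  haveI : UniqueFactorizationMonoid (X.presheaf.stalk x) := hX.uniqueFactorizationMonoid_stalk x
  obtain ⟨p, hp, hpeq⟩ := exists_prime_primeOfSpecializes_eq_span h hζ
  rw [hpeq, Ideal.span_singleton_pow]
  intro f hf
  rw [Ideal.mem_span_singleton]
  letI := (X.presheaf.stalkSpecializes h).hom.toAlgebra
  haveI : IsLocalization.AtPrime (X.presheaf.stalk ζ) (primeOfSpecializes h) :=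
    isLocalizationAtPrime_stalkSpecializes h
  refine pow_dvd_of_algebraMap_mem_map_pow (S := X.presheaf.stalk ζ) (primeOfSpecializes h)
    hp hpeq ?_
  have h1 : algebraMap _ (X.presheaf.stalk ζ) f ∈ stalkIdeal I ζ := by
    rw [← stalkIdeal_map_stalkSpecializes I h]
    exact Ideal.mem_map_of_mem _ hf
  have h2 := hn h1
  rwa [← IsLocalization.AtPrime.map_eq_maximalIdeal (primeOfSpecializes h) (X.presheaf.stalk ζ),
    ← Ideal.map_pow] at h2

/-- **The solid clause, generator form.**  On a regular scheme, let `I` have order at most `n` at `x` (`¬ I_x ⊆ 𝔪_x^{n+1}`),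
`1 ≤ n`, and let `ζ ⤳ x` be a codimension-one generisation in the support (`I_ζ ⊆ 𝔪_ζ^n`).  Then `𝔭_ζ = (p)` for a prime
`p ∉ 𝔪_x²` (the prime divisor `cl{ζ}` is REGULAR at `x`) and `I_x = (p^n)` EXACTLY. [new; elementary] [folklore] -/
theorem solid_generator (hX : Scheme.IsRegular X) {ζ x : X} (h : ζ ⤳ x) (hζ : Order.coheight ζ = 1)
    {I : X.IdealSheafData} {n : ℕ} (hn1 : 1 ≤ n)
    (hζn : stalkIdeal I ζ ≤ maximalIdeal (X.presheaf.stalk ζ) ^ n)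
    (hx : ¬ stalkIdeal I x ≤ maximalIdeal (X.presheaf.stalk x) ^ (n + 1)) :
    ∃ p : X.presheaf.stalk x, Prime p ∧ primeOfSpecializes h = Ideal.span {p} ∧
      p ∉ maximalIdeal (X.presheaf.stalk x) ^ 2 ∧ stalkIdeal I x = Ideal.span {p ^ n} := by
  haveI := hX x
  haveI : IsDomain (X.presheaf.stalk x) := isDomain_of_isRegularLocalRing _
  haveI : UniqueFactorizationMonoid (X.presheaf.stalk x) := hX.uniqueFactorizationMonoid_stalk x
  obtain ⟨p, hp, hpeq⟩ := exists_prime_primeOfSpecializes_eq_span h hζ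
  have hle : stalkIdeal I x ≤ Ideal.span {p ^ n} := by
    have := stalkIdeal_le_primeOfSpecializes_pow hX h hζ hζn
    rwa [hpeq, Ideal.span_singleton_pow] at this
  -- `p` lies in the maximal ideal (the prime `𝔭_ζ` is proper)
  have hpm : p ∈ maximalIdeal (X.presheaf.stalk x) := by
    have hne : primeOfSpecializes h ≠ ⊤ := Ideal.IsPrime.ne_top inferInstance
    have : p ∈ primeOfSpecializes h := by rw [hpeq]; exact Ideal.mem_span_singleton_self p
    exact IsLocalRing.le_maximalIdeal hne this
  refine ⟨p, hp, hpeq, ?_, ?_⟩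
  · -- `p ∈ 𝔪²` would force `I_x ⊆ (p^n) ⊆ 𝔪^{2n} ⊆ 𝔪^{n+1}`
    intro hp2
    apply hx
    refine hle.trans ?_
    rw [Ideal.span_singleton_le_iff_mem]
    have : p ^ n ∈ (maximalIdeal (X.presheaf.stalk x) ^ 2) ^ n := Ideal.pow_mem_pow hp2 n
    rw [← pow_mul] at this
    exact Ideal.pow_le_pow_right (by omega) this
  · -- `I_x = (p^n)`: otherwise every `f = p^n g ∈ I_x` has `g ∈ 𝔪`, so `I_x ⊆ (p^n)·𝔪 ⊆ 𝔪^{n+1}`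
    refine le_antisymm hle ?_
    rw [Ideal.span_singleton_le_iff_mem]
    by_contra hpn
    apply hx
    intro f hf
    obtain ⟨g, hg⟩ := Ideal.mem_span_singleton'.mp (hle hf)
    rw [← hg] at hf ⊢
    by_cases hgu : IsUnit g
    · exfalso
      apply hpn
      have : ↑hgu.unit⁻¹ * (g * p ^ n) ∈ stalkIdeal I x := Ideal.mul_mem_left _ _ hf
      rwa [← mul_assoc, IsUnit.val_inv_mul, one_mul] at this
    · have hgm : g ∈ maximalIdeal (X.presheaf.stalk x) := hgu
      have : g * p ^ n ∈ maximalIdeal (X.presheaf.stalk x) * maximalIdeal (X.presheaf.stalk x) ^ n :=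
        Ideal.mul_mem_mul hgm (Ideal.pow_mem_pow hpm n)
      rwa [← pow_succ'] at this

/-- **The solid clause, isolation form.**  In the situation of `solid_generator`, every generisation `ξ ⤳ x` at which
`I` is still a proper ideal (`I_ξ ≠ 𝒪_{X,ξ}` — e.g. any point of the support `{ord ≥ n}`, indeed of `V(I)`) is a specialisation
of `ζ`: **`ζ ⤳ ξ`, i.e. `ξ ∈ cl{ζ}`**.  Hence no irreducible closed subset of `V(I)` other than those inside `E = cl{ζ}` passes
through a point of `E`: the codimension-one components of the support are isolated. [new; elementary] [folklore] -/
theorem solid_isolated (hX : Scheme.IsRegular X) {ζ x : X} (h : ζ ⤳ x) (hζ : Order.coheight ζ = 1)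
    {I : X.IdealSheafData} {n : ℕ} (hn1 : 1 ≤ n)
    (hζn : stalkIdeal I ζ ≤ maximalIdeal (X.presheaf.stalk ζ) ^ n)
    (hx : ¬ stalkIdeal I x ≤ maximalIdeal (X.presheaf.stalk x) ^ (n + 1))
    {ξ : X} (hξ : ξ ⤳ x) (hξI : stalkIdeal I ξ ≠ ⊤) : ζ ⤳ ξ := by
  obtain ⟨p, hp, hpeq, -, hIx⟩ := solid_generator hX h hζ hn1 hζn hx
  -- `p ∈ 𝔭_ξ`: otherwise `p` becomes a unit in `𝒪_{X,ξ}` and `I_ξ = I_x·𝒪_{X,ξ} = (p^n)·𝒪_{X,ξ} = ⊤`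
  have hpξ : p ∈ primeOfSpecializes hξ := by
    by_contra hpξ
    apply hξI
    have hu : IsUnit ((X.presheaf.stalkSpecializes hξ).hom p) := by
      by_contra hu
      exact hpξ ((IsLocalRing.mem_maximalIdeal _).mpr hu)
    rw [← stalkIdeal_map_stalkSpecializes I hξ, hIx, Ideal.map_span, Set.image_singleton, map_pow,
      Ideal.span_singleton_eq_top]
    exact hu.pow n
  have hle : primeOfSpecializes h ≤ primeOfSpecializes hξ := by
    rw [hpeq, Ideal.span_singleton_le_iff_mem]
    exact hpξ
  exact specializes_of_primeOfSpecializes_le hξ h hle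

/-- Order at most `n` at `x` in the `idealOrder` language: `ord_x I ≤ n ⇒ ¬ I_x ⊆ 𝔪_x^{n+1}`. [folklore] -/
theorem not_stalkIdeal_le_pow_succ_of_idealOrder_le {I : X.IdealSheafData} {x : X} {n : ℕ}
    (h : idealOrder I x ≤ (n : ℕ∞)) : ¬ stalkIdeal I x ≤ maximalIdeal (X.presheaf.stalk x) ^ (n + 1) := by
  intro hle
  have h1 : ((n + 1 : ℕ) : ℕ∞) ≤ idealOrder I x := (le_idealOrder_iff I x (n + 1)).mpr hle
  have h2 : ((n + 1 : ℕ) : ℕ∞) ≤ (n : ℕ∞) := h1.trans h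
  have h3 : n + 1 ≤ n := by exact_mod_cast h2
  omega

end SolidClause

section SolidClauseMarked

namespace MarkedIdeal

/-- **The solid clause for marked ideals, isolation form.**  On a regular scheme let `M = (I, n)` be a marked ideal with
`1 ≤ n` and `ord_y I ≤ n` for every `y` (the column's `IsDatum`).  If `ζ ∈ supp M` has codimension one and `ζ ⤳ x`, then
every `ξ ∈ supp M` with `ξ ⤳ x` satisfies `ζ ⤳ ξ` (lies on the prime divisor `cl{ζ}`): a three-dimensional component of the
support of a datum on a regular fourfold meets no other component. [new; elementary] [folklore] -/
theorem specializes_of_mem_support_of_coheight_eq_one (hX : Scheme.IsRegular X) (M : MarkedIdeal X)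
    (hn1 : 1 ≤ M.mult) (hord : ∀ y : X, idealOrder M.ideal y ≤ (M.mult : ℕ∞))
    {ζ : X} (hζ : Order.coheight ζ = 1) (hζS : ζ ∈ M.support) {x : X} (h : ζ ⤳ x)
    {ξ : X} (hξ : ξ ⤳ x) (hξS : ξ ∈ M.support) : ζ ⤳ ξ := by
  have hζn := (M.mem_support_iff ζ).mp hζS
  have hξn := (M.mem_support_iff ξ).mp hξS
  refine solid_isolated hX h hζ hn1 hζn (not_stalkIdeal_le_pow_succ_of_idealOrder_le (hord x)) hξ ?_
  intro htop
  rw [htop, top_le_iff] at hξn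
  haveI := hX ξ
  have : (1 : X.presheaf.stalk ξ) ∈ maximalIdeal (X.presheaf.stalk ξ) :=
    Ideal.pow_le_self (by omega) (hξn ▸ Submodule.mem_top)
  exact (IsLocalRing.maximalIdeal.isMaximal _).ne_top (Ideal.eq_top_of_isUnit_mem _ this isUnit_one)

/-- **The solid clause for marked ideals, generator form**: with the same hypotheses, at every `x ∈ cl{ζ}` the stalk is
`I_x = (p^n)` for a prime `p ∉ 𝔪_x²` generating `𝔭_ζ` — near a codimension-one component `E` of its support, an
order-bounded marked ideal `(I, n)` IS `𝓘_E^n`, and `E` is regular. [new; elementary] [folklore] -/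
theorem exists_generator_of_mem_support_of_coheight_eq_one (hX : Scheme.IsRegular X) (M : MarkedIdeal X)
    (hn1 : 1 ≤ M.mult) (hord : ∀ y : X, idealOrder M.ideal y ≤ (M.mult : ℕ∞))
    {ζ : X} (hζ : Order.coheight ζ = 1) (hζS : ζ ∈ M.support) {x : X} (h : ζ ⤳ x) :
    ∃ p : X.presheaf.stalk x, Prime p ∧ primeOfSpecializes h = Ideal.span {p} ∧
      p ∉ maximalIdeal (X.presheaf.stalk x) ^ 2 ∧ stalkIdeal M.ideal x = Ideal.span {p ^ M.mult} :=
  solid_generator hX h hζ hn1 ((M.mem_support_iff ζ).mp hζS)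
    (not_stalkIdeal_le_pow_succ_of_idealOrder_le (hord x))

/-- In particular every point of a codimension-one component of the support has order EXACTLY `n` and the support is,
near it, the prime divisor: `x ∈ supp M` for every `x ∈ cl{ζ}` (closedness along `E`, for the record). [folklore] -/
theorem mem_support_of_specializes_of_coheight_eq_one (hX : Scheme.IsRegular X) (M : MarkedIdeal X)
    (hn1 : 1 ≤ M.mult) (hord : ∀ y : X, idealOrder M.ideal y ≤ (M.mult : ℕ∞))
    {ζ : X} (hζ : Order.coheight ζ = 1) (hζS : ζ ∈ M.support) {x : X} (h : ζ ⤳ x) : x ∈ M.support := by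
  obtain ⟨p, -, hpeq, -, hIx⟩ := exists_generator_of_mem_support_of_coheight_eq_one hX M hn1 hord hζ hζS h
  rw [M.mem_support_iff, hIx, Ideal.span_singleton_le_iff_mem]
  haveI := hX x
  have hpm : p ∈ maximalIdeal (X.presheaf.stalk x) := by
    have hne : primeOfSpecializes h ≠ ⊤ := Ideal.IsPrime.ne_top inferInstance
    have : p ∈ primeOfSpecializes h := by rw [hpeq]; exact Ideal.mem_span_singleton_self p
    exact IsLocalRing.le_maximalIdeal hne this
  exact Ideal.pow_mem_pow hpm _

end MarkedIdeal

end SolidClauseMarked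

end Literature.AlgebraicGeometry.Resolution

end
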